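import Summits.ValiantsHypothesis.ValiantsHypothesis.Theorems.FifoMatchingNNDivisionHardFaceBlindRung

/-!
# FACE-BLIND / GENERATOR form of the located read on the zonotope chapter of COR-VIRTUAL (crux `NNDivisionHard`, stmt-ValiantsHypothesis-21181) — part 3/5 — §12: THE FEW-ZONES LAW in kernel via the ONE-BLOCK avoidance count

Theorems-side port (val-port-1 g3, presser; desk RULING #357 (A); declaration texts VERBATIM) of val-idea-41 g3's crux workfile
`Cruxes/NNDivisionHard/FaceBlind.lean` REV 7 @025cc0a9aa76 (sha16 588eb2e00eeb6290, 1599 l.; critic of record val-idea-crit-9 g2 VERDICT #43: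
VERIFIED, KEEP §G(4)+(3), axioms standard), split by the 400-line cap into five chained modules `…FaceBlind` (§1–§10: typed statements,
`captureIffRefines`, `classZReduction`, `zonoEnemy_covers`) → `…FaceBlindRung` (§11: `zonoGenBlindAtDecided_holds`) → `…FaceBlindFewZones`
(§12: `fewZonesLaw_oneBlock`) → `…FaceBlindCliqueZone` (§13: `covZonoHard_cliqueZone`) → `…FaceBlindCount` (§14: `covZonoHardClique_holds`).
DEDUP (desk: import, do not copy): the workfile's verbatim pastes of landed declarations are REPLACED by imports — `Jdir` :=
`ExposedFibre.Jdir` (✓ `…ExposedFibreRung`), `exists_large_avoid` / `exists_generic_comb` := `LowDim.*` (✓ `…LowDimFace`), `chi` / `uVec` / `uPush` /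
`sum_uVec_chi` / `negRankOne_dot_corVec` / `sum_uPush_chi` := `ConePricing.*` (✓ `…ConePricing`); the pasted one-cut-rung lemmas of val-idea-40
(`admissible_blockDir`, `Admissible.dot_eq_zero_iff/dot_le/face_eq`, `exposedFibreRung_holds`, `exposedFibreDecided_holds`) keep their FOLDED
statements here and are PROVED BY CITATION of the δ-unfolded landed theorems `ExposedFibre.*` (✓ p674xxx `…ExposedFibreRung`, val-port-4 g3 /
val-idea-40 g4).  Namespace `…Theorems.FifoMatching.FaceBlind` (workfile: `…Cruxes.NNDivisionHard.FaceBlind41`).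

* `eq_smul_Jdir_of_sameRow`, `exists_oneBlock_avoiding` (the one-block avoidance count replacing `EquipartitionAvoidance`), ★★ `fewZonesLaw_oneBlock :
  FewZonesLawOneBlock`, `fewZones_decided`.

HONEST LABEL: helper rows for an OPEN crux (21181 `NNDivisionHard` OPEN; `CovZonoHard` OPEN for general zonotopal passengers); nothing here is a
summit statement; VP ≠ VNP is NOT proved.
-/

set_option autoImplicit false
set_option linter.dupNamespace false

noncomputable section
open Matrix Finset
open scoped Pointwise

namespace Summit.ValiantsHypothesis.ValiantsHypothesis.Theorems.FifoMatching.FaceBlind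

open Literature.Barriers.PneNP (HasEFOfSize)
open Literature.Combinatorics.Optimization (corPolytopeGraph corVec)
open Summit.ValiantsHypothesis.ValiantsHypothesis.Theorems.FifoMatching.ExposedFibre (Jdir)

variable {n m : ℕ}

/-! ## 12. THE FEW-ZONES LAW IN KERNEL — `EquipartitionAvoidance` replaced by a ONE-BLOCK avoidance count

To feed `zonoGenBlindAtDecided_holds` one needs a level-`m'` block map `β` (with a section) capturing NO zone off `ℝJ`.
Instead of the sharp equipartition double count (38/40's `EquipartitionAvoidance`, threshold `C(m't,t)/m'` zones) we use ONE
block: `B = {x₀} ∪ R` with `R` a `(t-1)`-subset of `[h] ∖ {x₀}`, the other `m'-1` blocks arbitrary of size `≥ t`.  A captured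
zone `g ∉ ℝJ` has a row class `A ∌` everything (✓ `captureIffRefines`); if `|A(x₀)| ≤ h - t` then `B ⊆ A(x₀)` costs `R` one of
`≤ C(h-t-1, t-1)` positions; if `|A(x₀)| > h - t` the complement (nonempty, `< t` points) cannot be a union of blocks of size
`≥ t`.  Union bound: `M·C(h-t-1,t-1) < C(h-1,t-1)` suffices — threshold `C(h-1,t-1)/C(h-t-1,t-1) ≥ (1 + t/(h-t))^{t-1}
≈ e^{t²/h} = e^{h/m'²}` zones at `t = h/m'`, i.e. STILL `2^{h^{1-o(1)}}` at `m' = polylog h`: the headline law survives with a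
weaker constant in the exponent, and is now a KERNEL THEOREM (`fewZonesLaw_oneBlock`). -/

section FewZones
open Summit.ValiantsHypothesis.ValiantsHypothesis.Theorems.FifoMatching.LocatedFaceExposure

/-- all rows equal (to row `x₀`) and symmetric ⇒ a multiple of `J`. -/
theorem eq_smul_Jdir_of_sameRow {g : Fin n × Fin n → ℝ} (hsym : ∀ p q, g (p, q) = g (q, p)) (x₀ : Fin n)
    (hall : ∀ q, SameRow g x₀ q) : ∃ α : ℝ, g = α • Jdir n := by
  refine ⟨g (x₀, x₀), funext fun pq => ?_⟩
  obtain ⟨p, q⟩ := pq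
  simp only [Pi.smul_apply, Jdir, smul_eq_mul, mul_one]
  rw [← hall p q, hsym x₀ q, ← hall q x₀]

/-- ★ ONE-BLOCK AVOIDANCE: `M` zones, level `m' ≥ 2`, block size `t ≥ 1`, `m'·t ≤ h`, and `M·C(h-t-1,t-1) < C(h-1,t-1)` ⇒ a
level-`m'` block map with a section capturing no zone off `ℝJ`. -/
theorem exists_oneBlock_avoiding (h m' t M : ℕ) (hm : 2 ≤ m') (ht : 1 ≤ t) (hh : m' * t ≤ h)
    (gen : Fin M → (Fin h × Fin h → ℝ))
    (hcount : M * Nat.choose (h - t - 1) (t - 1) < Nat.choose (h - 1) (t - 1)) :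
    ∃ (β : Fin h → Fin m') (ρ : Fin m' → Fin h), (∀ j, β (ρ j) = j) ∧
      ∀ i, BlockConstSymGen β (gen i) → ∃ α : ℝ, gen i = α • Jdir h := by
  classical
  obtain ⟨m₂, rfl⟩ : ∃ m₂, m' = m₂ + 2 := ⟨m' - 2, by omega⟩
  have ht0 : 0 < t := ht
  have hh' : m₂ * t + 2 * t ≤ h := by rw [add_mul] at hh; omega
  let x₀ : Fin h := ⟨0, by omega⟩
  -- row classes of `x₀`
  let A : Fin M → Finset (Fin h) := fun i => Finset.univ.filter fun q => SameRow (gen i) x₀ q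
  have hx₀A : ∀ i, x₀ ∈ A i := fun i => Finset.mem_filter.2 ⟨Finset.mem_univ _, fun _ => rfl⟩
  -- bad positions for `R`
  let bad : Fin M → Finset (Finset (Fin h)) := fun i =>
    if (A i).card ≤ h - t then Finset.powersetCard (t - 1) ((A i).erase x₀) else ∅
  have hbad_card : ∀ i, (bad i).card ≤ Nat.choose (h - t - 1) (t - 1) := by
    intro i
    simp only [bad]
    split_ifs with hsm
    · rw [Finset.card_powersetCard, Finset.card_erase_of_mem (hx₀A i)]
      exact Nat.choose_le_choose _ (by omega)
    · simp
  have hU : (Finset.univ.biUnion bad).card ≤ M * Nat.choose (h - t - 1) (t - 1) :=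
    calc (Finset.univ.biUnion bad).card ≤ ∑ i, (bad i).card := Finset.card_biUnion_le
      _ ≤ ∑ _i : Fin M, Nat.choose (h - t - 1) (t - 1) := Finset.sum_le_sum fun i _ => hbad_card i
      _ = M * Nat.choose (h - t - 1) (t - 1) := by simp
  have hP : (Finset.powersetCard (t - 1) (Finset.univ.erase x₀)).card = Nat.choose (h - 1) (t - 1) := by
    rw [Finset.card_powersetCard, Finset.card_erase_of_mem (Finset.mem_univ _), Finset.card_univ, Fintype.card_fin]
  obtain ⟨R, hRP, hRU⟩ : ∃ R ∈ Finset.powersetCard (t - 1) (Finset.univ.erase x₀), R ∉ Finset.univ.biUnion bad := by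
    by_contra hcon
    push Not at hcon
    have := Finset.card_le_card (show Finset.powersetCard (t - 1) (Finset.univ.erase x₀) ⊆ Finset.univ.biUnion bad
      from fun S hS => hcon S hS)
    omega
  obtain ⟨hRsub, hRcard⟩ := Finset.mem_powersetCard.1 hRP
  have hx₀R : x₀ ∉ R := fun hx => (Finset.mem_erase.1 (hRsub hx)).1 rfl
  have hRgood : ∀ i, R ∉ bad i := fun i hi => hRU (Finset.mem_biUnion.2 ⟨i, Finset.mem_univ _, hi⟩)
  -- the block `B` and its complement `C`
  let B : Finset (Fin h) := insert x₀ R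
  have hx₀B : x₀ ∈ B := Finset.mem_insert_self _ _
  have hBcard : B.card = t := by
    simp only [B]
    rw [Finset.card_insert_of_notMem hx₀R]
    omega
  let C : Finset (Fin h) := Finset.univ \ B
  have hCcard : C.card = h - t := by
    simp only [C]
    rw [Finset.card_univ_sdiff, Fintype.card_fin, hBcard]
  have memC : ∀ {q : Fin h}, q ∉ B → q ∈ C := fun hq => Finset.mem_sdiff.2 ⟨Finset.mem_univ _, hq⟩
  have notB_of_memC : ∀ {q : Fin h}, q ∈ C → q ∉ B := fun hq => (Finset.mem_sdiff.1 hq).2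
  obtain ⟨e⟩ : Nonempty ({q // q ∈ C} ≃ Fin (h - t)) :=
    ⟨Fintype.equivFinOfCardEq (by rw [Fintype.card_coe, hCcard])⟩
  -- labels, the block map, its section
  obtain ⟨lab, hlab⟩ : ∃ lab : ℕ → Fin (m₂ + 2), ∀ i, (lab i).val = 1 + min (i / t) m₂ :=
    ⟨fun i => ⟨1 + min (i / t) m₂, by have := min_le_right (i / t) m₂; omega⟩, fun _ => rfl⟩
  obtain ⟨β, hβB, hβC⟩ : ∃ β : Fin h → Fin (m₂ + 2), (∀ q, q ∈ B → β q = ⟨0, by omega⟩) ∧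
      ∀ q (hq : q ∉ B), β q = lab (e ⟨q, memC hq⟩).val :=
    ⟨fun q => if hq : q ∈ B then ⟨0, by omega⟩ else lab (e ⟨q, memC hq⟩).val,
      fun q hq => dif_pos hq, fun q hq => dif_neg hq⟩
  have hρidx : ∀ j : Fin (m₂ + 2), j.val ≠ 0 → (j.val - 1) * t < h - t := fun j hj => by
    have := Nat.mul_le_mul_right t (show j.val - 1 ≤ m₂ by omega)
    omega
  obtain ⟨ρ, hρ0, hρ1⟩ : ∃ ρ : Fin (m₂ + 2) → Fin h, (∀ j, j.val = 0 → ρ j = x₀) ∧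
      ∀ j (hj : j.val ≠ 0), ρ j = (e.symm ⟨(j.val - 1) * t, hρidx j hj⟩).val :=
    ⟨fun j => if hj : j.val = 0 then x₀ else (e.symm ⟨(j.val - 1) * t, hρidx j hj⟩).val,
      fun j hj => dif_pos hj, fun j hj => dif_neg hj⟩
  -- the label of the `e`-index `k + (j-1)·t` is `j`
  have hlab_idx : ∀ (j : Fin (m₂ + 2)) (k : ℕ), j.val ≠ 0 → k < t → lab (k + (j.val - 1) * t) = j := by
    intro j k hj hk
    apply Fin.ext
    rw [hlab, Nat.add_mul_div_right _ _ ht0, Nat.div_eq_of_lt hk, zero_add, min_eq_left (by omega : j.val - 1 ≤ m₂)]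
    omega
  have hβe : ∀ (idx : Fin (h - t)), β (e.symm idx).val = lab idx.val := by
    intro idx
    have hnot : (e.symm idx).val ∉ B := notB_of_memC (e.symm idx).2
    rw [hβC _ hnot]
    congr 2
    rw [Subtype.coe_eta, Equiv.apply_symm_apply]
  refine ⟨β, ρ, fun j => ?_, fun i hcap => ?_⟩
  · -- section
    by_cases hj : j.val = 0
    · rw [hρ0 j hj, hβB x₀ hx₀B]
      exact Fin.ext (by simp [hj])
    · rw [hρ1 j hj, hβe]
      have := hlab_idx j 0 hj ht0
      rwa [zero_add] at this
  · -- no zone off `ℝJ` is captured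
    have hsym := hcap.1
    have href : ∀ p p', β p = β p' → SameRow (gen i) p p' := (captureIffRefines h (m₂ + 2) β (gen i) hsym).1 hcap
    by_cases hall : ∀ q, SameRow (gen i) x₀ q
    · exact eq_smul_Jdir_of_sameRow hsym x₀ hall
    exfalso
    push Not at hall
    obtain ⟨q₀, hq₀⟩ := hall
    by_cases hsm : (A i).card ≤ h - t
    · -- small class: `R ⊆ A(x₀) ∖ {x₀}` is a bad position
      refine hRgood i ?_
      have hbad : bad i = Finset.powersetCard (t - 1) ((A i).erase x₀) := if_pos hsm
      rw [hbad]
      refine Finset.mem_powersetCard.2 ⟨fun p hp => ?_, hRcard⟩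
      have hpB : p ∈ B := Finset.mem_insert_of_mem hp
      have hpx : p ≠ x₀ := fun h0 => hx₀R (h0 ▸ hp)
      refine Finset.mem_erase.2 ⟨hpx, Finset.mem_filter.2 ⟨Finset.mem_univ _, href x₀ p ?_⟩⟩
      rw [hβB x₀ hx₀B, hβB p hpB]
    · -- big class: the block of `q₀` has `≥ t` points outside `A(x₀)`, which has `< t` points outside
      push Not at hsm
      have hq₀B : q₀ ∉ B := fun hq => hq₀ (href x₀ q₀ (by rw [hβB x₀ hx₀B, hβB q₀ hq]))
      have hj : (β q₀).val ≠ 0 := by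
        rw [hβC q₀ hq₀B, hlab]
        exact (Nat.add_pos_left Nat.one_pos _).ne'
      have hidx : ∀ k : Fin t, k.val + ((β q₀).val - 1) * t < h - t := fun k => by
        have := hρidx (β q₀) hj
        have := Nat.mul_le_mul_right t (show (β q₀).val - 1 ≤ m₂ by omega)
        omega
      obtain ⟨pk, hpk⟩ : ∃ pk : Fin t → Fin h, ∀ k, pk k = (e.symm ⟨k.val + ((β q₀).val - 1) * t, hidx k⟩).val :=
        ⟨fun k => (e.symm ⟨k.val + ((β q₀).val - 1) * t, hidx k⟩).val, fun _ => rfl⟩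
      have hpk_inj : Function.Injective pk := by
        intro k₁ k₂ hk
        rw [hpk, hpk] at hk
        have h1 := e.symm.injective (Subtype.val_injective hk)
        rw [Fin.mk.injEq] at h1
        exact Fin.ext (by omega)
      have hβpk : ∀ k, β (pk k) = β q₀ := fun k => by
        rw [hpk, hβe]
        exact hlab_idx (β q₀) k.val hj k.isLt
      have hpk_notA : ∀ k, pk k ∉ A i := fun k hk => hq₀ (by
        have h1 : SameRow (gen i) x₀ (pk k) := (Finset.mem_filter.1 hk).2
        have h2 : SameRow (gen i) q₀ (pk k) := href q₀ (pk k) (hβpk k).symm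
        exact fun q => (h1 q).trans (h2 q).symm)
      have hcard_le : t ≤ (Finset.univ \ A i).card :=
        calc t = (Finset.univ.image pk).card := by
              rw [Finset.card_image_of_injective _ hpk_inj, Finset.card_univ, Fintype.card_fin]
          _ ≤ (Finset.univ \ A i).card := Finset.card_le_card fun p hp => by
              obtain ⟨k, -, rfl⟩ := Finset.mem_image.1 hp
              exact Finset.mem_sdiff.2 ⟨Finset.mem_univ _, hpk_notA k⟩
      rw [Finset.card_univ_sdiff, Fintype.card_fin] at hcard_le
      have hAle : (A i).card ≤ h := by simpa using (A i).card_le_univ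
      omega

/-- ★ THE FEW-ZONES LAW, one-block form (statement). -/
def FewZonesLawOneBlock : Prop :=
  ∀ (h m' t M : ℕ) (gen : Fin M → (Fin h × Fin h → ℝ)) (w : Fin h × Fin h → ℝ) (r : ℕ),
    2 ≤ m' → 1 ≤ t → m' * t ≤ h → M * Nat.choose (h - t - 1) (t - 1) < Nat.choose (h - 1) (t - 1) →
    HasEFOfSize (corPolytopeGraph (⊤ : SimpleGraph (Fin h)) + convexHull ℝ (Set.range (subsetSum gen w))) r →
      (3 / 2 : ℝ) ^ (m' - 1) ≤ 2 * (r + 1)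

/-- ★★ THE FEW-ZONES LAW IS A KERNEL THEOREM: every zonotopal passenger `Z = w + Σ [0,1]·gen i` with
`M·C(h-t-1,t-1) < C(h-1,t-1)` zones (any `t ≥ 1`, `m' ≥ 2`, `m'·t ≤ h`) obeys `(3/2)^{m'-1} ≤ 2(r+1)` whenever `COR(K_h) + Z` has
an extended formulation of size `r` — `exists_oneBlock_avoiding` + `zonoGenBlindAtDecided_holds`.  At `m' = 2(log₂ h + C)^C + 4`,
`t = h / m'` this DECIDES (in the crux's shape `2^{(log₂ h + C)^C} < r`, via the arithmetic of `lt_of_not_covers`) every zonotope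
with `≤ 2^{h^{1-o(1)}}` zones. -/
theorem fewZonesLaw_oneBlock : FewZonesLawOneBlock := by
  classical
  intro h m' t M gen w r hm ht hh hcount hEF
  obtain ⟨β, ρ, hρ, hZ⟩ := exists_oneBlock_avoiding h m' t M hm ht hh gen hcount
  obtain ⟨K', ⟨e⟩⟩ : ∃ K', Nonempty (Finset (Fin M) ≃ Fin (K' + 1)) := by
    refine ⟨Fintype.card (Finset (Fin M)) - 1, ⟨(Fintype.equivFin _).trans (finCongr ?_)⟩⟩
    have : 0 < Fintype.card (Finset (Fin M)) := Fintype.card_pos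
    omega
  have hq : Set.range (subsetSum gen w ∘ e.symm) = Set.range (subsetSum gen w) :=
    Function.Surjective.range_comp e.symm.surjective _
  refine zonoGenBlindAtDecided_holds h m' K' (subsetSum gen w ∘ e.symm) r
    ⟨β, ρ, hρ, M, gen, w, by rw [hq], hZ⟩ ?_
  rw [hq]
  exact hEF

/-- ★ COROLLARY — the few-zones law IN THE CRUX'S SHAPE: at level `m' = 2(log₂ h + C)^C + 4`, a zonotopal passenger with
`M·C(h-t-1,t-1) < C(h-1,t-1)` zones (some `t ≥ 1`, `m'·t ≤ h`) is DECIDED — `2^{(log₂ h + C)^C} < r` for every extended formulation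
of `COR(K_h) + Z` of size `r`. -/
theorem fewZones_decided (C h t M : ℕ) (gen : Fin M → (Fin h × Fin h → ℝ)) (w : Fin h × Fin h → ℝ) (r : ℕ) (ht : 1 ≤ t)
    (hh : (2 * (Nat.log 2 h + C) ^ C + 4) * t ≤ h)
    (hcount : M * Nat.choose (h - t - 1) (t - 1) < Nat.choose (h - 1) (t - 1))
    (hR : HasEFOfSize (corPolytopeGraph (⊤ : SimpleGraph (Fin h)) + convexHull ℝ (Set.range (subsetSum gen w))) r) :
    2 ^ ((Nat.log 2 h + C) ^ C) < r := by
  set L := (Nat.log 2 h + C) ^ C with hLdef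
  have hdec := fewZonesLaw_oneBlock h (2 * L + 4) t M gen w r (by omega) ht hh hcount hR
  have hm : 2 * L + 4 - 1 = 2 * L + 3 := by omega
  rw [hm] at hdec
  have hL : 1 ≤ L := one_le_L h C
  have h1 : (2 : ℝ) ≤ 2 ^ L := by
    calc (2 : ℝ) = 2 ^ 1 := by norm_num
      _ ≤ 2 ^ L := pow_le_pow_right₀ (by norm_num) hL
  have h2 : (2 : ℝ) ^ L ≤ (9 / 4) ^ L := pow_le_pow_left₀ (by norm_num) (by norm_num) L
  have key : (3 / 2 : ℝ) ^ (2 * L + 3) = (9 / 4) ^ L * (27 / 8) := by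
    rw [pow_add, pow_mul]; norm_num
  rw [key] at hdec
  have hlt : (2 : ℝ) ^ L < r := by linarith
  exact_mod_cast hlt

end FewZones

end Summit.ValiantsHypothesis.ValiantsHypothesis.Theorems.FifoMatching.FaceBlind

end
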